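import Literature.AlgebraicGeometry.ShimuraVarieties.UnitaryBallCotangentReproducingKernel
import HarnessLib

/-!
# The reproducing kernel of holomorphic cotangent forms on `U(2,1)` is `C¹` (indeed `C^∞`) along the left `𝔭`-probes,
# with jointly continuous probe derivative — the `IsRegularKernel` clauses of the floor-0 (D) desk

Topic `AlgebraicGeometry/ShimuraVarieties`; namespace `Literature.AlgebraicGeometry.ShimuraVarieties.BallForms`.  THEOREMS ONLY;
imports ★ `UnitaryBallCotangentReproducingKernel` (the kernel `reproducingKernel κ = extKernel κ ∘ mat`, `contDiffAt_extKernel`).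

For the (D)-desk line `Cruxes/H413/Lines/F0_P2SpectralProjectionD.lean` (F0P2-plan (g2), v1.1) the kernel stub (K) asks, besides
continuity and compact support, that for all `j i` and `u′ ∈ U(2,1)` the probe `b ↦ A(exp X_b · u′)_{ji}` be `C¹` on `ℂ² ≅ 𝔭` and that
`(b, u′) ↦ ∂_b A(exp X_b · u′)_{ji}` be jointly continuous (differentiation under `∫ … dν(u′)`).  Both follow from the extrinsic smoothness
`A = Ã ∘ mat`, `Ã` smooth at `mat(U(2,1))` (★ `contDiffAt_extKernel`), and the smoothness of `b ↦ mat(exp X_b) = exp(pMat b)`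
(Mathlib `NormedSpace.exp_analytic`, ★ `pMatL`): the probe is `b ↦ F(b, mat u′)` for the jointly smooth
`F(b, M) = Ã(exp(pMat b) · M)_{ji}` (`probeFun`), and its `b`-derivative is the partial derivative of `F`, continuous in `(b, M)`.
HC_CM is proved only modulo the printed citations until rung 0 closes.

## References
* [Borel1997] A. Borel, *Automorphic forms on SL₂(ℝ)* (1997), §2.13–2.14 (smoothing by compactly supported kernels), §5.14.
* [Rudin1980] W. Rudin, *Function Theory in the Unit Ball of ℂⁿ* (1980), §2.2.
-/

set_option autoImplicit false

noncomputable section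

open MulAction Matrix
open scoped Matrix Matrix.Norms.Operator ContDiff Topology
open Literature.Geometry.ComplexHyperbolic
open Literature.Geometry.ComplexHyperbolic.BallModel

namespace Literature.AlgebraicGeometry.ShimuraVarieties.BallForms

/-- `b ↦ exp(X_b) = mat (expP b)` is real-smooth (`exp` is analytic on the Banach algebra `M₃(ℂ)`, `X_b` is `ℝ`-linear in `b`).
[cite: Rudin1980, §2.2] -/
theorem contDiff_exp_pMat {n : WithTop ℕ∞} : ContDiff ℝ n fun b : Fin 2 → ℂ => NormedSpace.exp (pMat b) := by
  rw [contDiff_iff_contDiffAt]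
  intro b
  have h : ContDiffAt ℝ n (NormedSpace.exp : Matrix (Fin 3) (Fin 3) ℂ → Matrix (Fin 3) (Fin 3) ℂ) (pMatL b) :=
    (NormedSpace.exp_analytic (𝕂 := ℝ) (pMatL b)).contDiffAt.of_le le_top
  exact h.comp b pMatL.contDiff.contDiffAt

/-- **The two-variable probe function** `F_{ji}(b, M) = Ã_κ(exp(X_b) · M)_{ji}` on `ℂ² × M₃(ℂ)`. [cite: Borel1997, §2.13–2.14] -/
theorem probe_eq_extKernel (κ : ℝ) (j i : Fin 2) (b : Fin 2 → ℂ) (u' : U21) :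
    reproducingKernel κ (expP b * u') j i = extKernel κ (NormedSpace.exp (pMat b) * mat u') j i := by
  rw [reproducingKernel_eq_extKernel, mat_mul, mat_expP]

/-- the two-variable probe function is real-smooth at every `(b, mat u′)`. [cite: Borel1997, §2.13–2.14] -/
theorem contDiffAt_probeFun (κ : ℝ) (j i : Fin 2) (b : Fin 2 → ℂ) (u' : U21) :
    ContDiffAt ℝ ∞ (fun p : (Fin 2 → ℂ) × Matrix (Fin 3) (Fin 3) ℂ => extKernel κ (NormedSpace.exp (pMat p.1) * p.2) j i)
      (b, mat u') := by
  have hmul : ContDiffAt ℝ ∞ (fun p : (Fin 2 → ℂ) × Matrix (Fin 3) (Fin 3) ℂ => NormedSpace.exp (pMat p.1) * p.2) (b, mat u') :=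
    (contDiff_exp_pMat.contDiffAt.comp _ contDiffAt_fst).mul contDiffAt_snd
  have hpt : NormedSpace.exp (pMat b) * mat u' = mat (expP b * u') := by rw [mat_mul, mat_expP]
  have hext : ContDiffAt ℝ ∞ (extKernel κ) (NormedSpace.exp (pMat b) * mat u') := by
    rw [hpt]; exact contDiffAt_extKernel κ _
  have hcomp : ContDiffAt ℝ ∞ (fun p : (Fin 2 → ℂ) × Matrix (Fin 3) (Fin 3) ℂ => extKernel κ (NormedSpace.exp (pMat p.1) * p.2))
      (b, mat u') := ContDiffAt.comp (g := extKernel κ) (b, mat u') hext hmul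
  exact ((entryL j i).contDiff.contDiffAt.restrict_scalars ℝ).comp (b, mat u') hcomp

/-- **(K-diff) the probes `b ↦ A_κ(exp X_b · u′)_{ji}` are `C^n` for every `n`** (in particular `C¹`). [cite: Borel1997, §2.13–2.14] -/
theorem contDiff_reproducingKernel_probe (κ : ℝ) (j i : Fin 2) (u' : U21) {n : WithTop ℕ∞} (hn : n ≤ ∞) :
    ContDiff ℝ n fun b : Fin 2 → ℂ => reproducingKernel κ (expP b * u') j i := by
  have heq : (fun b : Fin 2 → ℂ => reproducingKernel κ (expP b * u') j i) =
      fun b => (fun p : (Fin 2 → ℂ) × Matrix (Fin 3) (Fin 3) ℂ => extKernel κ (NormedSpace.exp (pMat p.1) * p.2) j i) (b, mat u') := by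
    funext b; exact probe_eq_extKernel κ j i b u'
  rw [heq, contDiff_iff_contDiffAt]
  intro b
  exact ((contDiffAt_probeFun κ j i b u').of_le hn).comp b (contDiffAt_id.prodMk contDiffAt_const)

/-- **(K-contDeriv) the probe derivative `(b, u′) ↦ ∂_b A_κ(exp X_b · u′)_{ji}` is jointly continuous** (it is the partial derivative
of the jointly smooth two-variable probe function, read along the continuous `u′ ↦ mat u′`). [cite: Borel1997, §2.13–2.14] -/
theorem continuous_fderiv_reproducingKernel_probe (κ : ℝ) (j i : Fin 2) :
    Continuous fun p : (Fin 2 → ℂ) × U21 => fderiv ℝ (fun b : Fin 2 → ℂ => reproducingKernel κ (expP b * p.2) j i) p.1 := by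
  set F : (Fin 2 → ℂ) × Matrix (Fin 3) (Fin 3) ℂ → ℂ :=
    fun p => extKernel κ (NormedSpace.exp (pMat p.1) * p.2) j i with hF
  -- the probe derivative is the partial derivative of `F`
  have hderiv : ∀ p : (Fin 2 → ℂ) × U21,
      fderiv ℝ (fun b : Fin 2 → ℂ => reproducingKernel κ (expP b * p.2) j i) p.1 =
        (fderiv ℝ F (p.1, mat p.2)).comp (ContinuousLinearMap.inl ℝ (Fin 2 → ℂ) (Matrix (Fin 3) (Fin 3) ℂ)) := by
    intro p
    have heq : (fun b : Fin 2 → ℂ => reproducingKernel κ (expP b * p.2) j i) = fun b => F (b, mat p.2) := by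
      funext b; exact probe_eq_extKernel κ j i b p.2
    rw [heq]
    have hFd : HasFDerivAt F (fderiv ℝ F (p.1, mat p.2)) (p.1, mat p.2) :=
      ((contDiffAt_probeFun κ j i p.1 p.2).differentiableAt (by simp)).hasFDerivAt
    have hemb : HasFDerivAt (fun b : Fin 2 → ℂ => (b, mat p.2))
        (ContinuousLinearMap.inl ℝ (Fin 2 → ℂ) (Matrix (Fin 3) (Fin 3) ℂ)) p.1 :=
      (hasFDerivAt_id p.1).prodMk (hasFDerivAt_const (mat p.2) p.1)
    exact (hFd.comp p.1 hemb).fderiv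
  simp_rw [hderiv]
  -- continuity of `p ↦ fderiv F (p.1, mat p.2)`
  have hcont : Continuous fun p : (Fin 2 → ℂ) × U21 => fderiv ℝ F (p.1, mat p.2) := by
    rw [continuous_iff_continuousAt]
    intro p
    have h1 : ContinuousAt (fderiv ℝ F) (p.1, mat p.2) :=
      (contDiffAt_probeFun κ j i p.1 p.2).continuousAt_fderiv (by simp)
    have h2 : Continuous fun q : (Fin 2 → ℂ) × U21 => (q.1, mat q.2) :=
      continuous_fst.prodMk (continuous_mat.comp continuous_snd)
    exact ContinuousAt.comp (f := fun q : (Fin 2 → ℂ) × U21 => (q.1, mat q.2)) h1 h2.continuousAt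
  exact hcont.clm_comp continuous_const

end Literature.AlgebraicGeometry.ShimuraVarieties.BallForms

end
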